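import Literature.Geometry.Riemannian.ThreePieceGluedMetric
import HarnessLib

/-!
# Sub-goal of stub `stub_collarGluingIsometric` (crux `CorkRegluingBudget`, line `registered`,
# RESHAPE 4): the three-piece glued metric is isometric on the pieces

Registered sub-goal `exists_threePieceGluedMetric_isometric` of the stub
`stub_collarGluingIsometric` (item stmt-SmoothPoincare4-10831).  Let `P = G.d₂.Glued` be the
three-piece gluing `(M - ∂M) ∪ (∂M × ℝ) ∪ (N - ∂N)` of two manifolds with boundary along open
collars (`Literature.Topology.FourManifolds.BoundaryGlueData`, Milnor 1965, proof of Thm. 1.4),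
with pieces `jM : M → P`, `jN : N → P`, and let `g_M`, `g_N`, `g_S` be smooth metrics on `M`, `N`
and on the seam tube for which the two collar maps are isometries.  The tree's
`Literature.Geometry.Riemannian.exists_threePieceGluedMetric` (O'Neill 1983, Ch. 3, pp. 90–91 and
Prop. 3.59) produces the glued metric `g` on `P` together with the tube isometry, Riemannian-ness
and the scalar curvature on the three open pieces; its PROOF contains the interior isometries
`(inl ∘ inr)^* g = val^* g_M`, `inr^* g = val^* g_N`, but its statement does not export them.
Here we re-run that proof and export, in addition, the two **piece isometries**
`jM^* g = g_M` on all of `M` and `jN^* g = g_N` on all of `N`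
(`exists_threePieceGluedMetric_isometric`), which the Weyl-energy bookkeeping of the budget crux
needs.  At interior points this is the chain rule (`jM = (inl ∘ inr) ∘ ofPt` near an interior
point, `val ∘ ofPt = id`; `pullbackBilin_eq_of_isInteriorPoint`); at boundary points it follows
by continuity: two smooth fields of bilinear forms which agree frequently near a point agree at
the point (`bilin_eq_of_frequently_eq`, read in the trivialization of the bundle of bilinear
forms, `Literature.Geometry.Lorentzian.contMDiffAt_bilin_iff`), and every boundary point is a
limit of interior collar points (`mem_closure_isInteriorPoint`).  Everything here is proved; no
definitions, no named facts.

## References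

* B. O'Neill, *Semi-Riemannian Geometry* (1983), Ch. 3, Def. 3.9, p. 58, pp. 90–91, Prop. 3.59.
  [ONeill1983]
* J. Milnor, *Lectures on the h-cobordism theorem* (1965), §1, Thm. 1.4. [MilnorHCobordism1965]
-/

set_option linter.dupNamespace false

open scoped Manifold ContDiff Topology
open Set Function Filter Bundle

noncomputable section

namespace Summit.SmoothPoincare4.SmoothPoincare4.Theorems.CorkRegluingBudget

open Literature.Topology.FourManifolds Literature.Geometry.Lorentzian
  Literature.Geometry.Lorentzian.PseudoRiemannianMetric Literature.Geometry.Riemannian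

universe u

section Bricks

variable {E : Type*} [NormedAddCommGroup E] [NormedSpace ℝ E] {H : Type*} [TopologicalSpace H]
  {I : ModelWithCorners ℝ E H} {M : Type u} [TopologicalSpace M] [ChartedSpace H M]
  {EP : Type*} [NormedAddCommGroup EP] [NormedSpace ℝ EP] {HP : Type*} [TopologicalSpace HP]
  {IP : ModelWithCorners ℝ EP HP} {P : Type*} [TopologicalSpace P] [ChartedSpace HP P]
  {m : ℕ∞ω}

/-- **Two `C^m` fields of bilinear forms which agree frequently near `x₀` agree at `x₀`.**
Read both sections in the trivialization of the bundle of bilinear forms at `x₀`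
(`contMDiffAt_bilin_iff`): the coordinate expressions are continuous at `x₀` with values in the
normed space `E →L E →L ℝ`, agree frequently near `x₀`, hence agree at `x₀`
(`tendsto_nhds_unique_of_frequently_eq`); the trivialization at `x₀` is onto the fibre. [folklore] -/
theorem bilin_eq_of_frequently_eq [IsManifold I ∞ M]
    {s₁ s₂ : ∀ x : M, TangentSpace I x →L[ℝ] TangentSpace I x →L[ℝ] ℝ} {x₀ : M}
    (h₁ : ContMDiffAt I (I.prod 𝓘(ℝ, E →L[ℝ] E →L[ℝ] ℝ)) m
      (fun x ↦ TotalSpace.mk' (E →L[ℝ] E →L[ℝ] ℝ)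
        (E := fun x : M ↦ TangentSpace I x →L[ℝ] TangentSpace I x →L[ℝ] ℝ) x (s₁ x)) x₀)
    (h₂ : ContMDiffAt I (I.prod 𝓘(ℝ, E →L[ℝ] E →L[ℝ] ℝ)) m
      (fun x ↦ TotalSpace.mk' (E →L[ℝ] E →L[ℝ] ℝ)
        (E := fun x : M ↦ TangentSpace I x →L[ℝ] TangentSpace I x →L[ℝ] ℝ) x (s₂ x)) x₀)
    (h : ∃ᶠ x in 𝓝 x₀, s₁ x = s₂ x) : s₁ x₀ = s₂ x₀ := by
  have c₁ := ((contMDiffAt_bilin_iff (IX := I) (IB := I) (V := (TangentSpace I : M → Type _))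
    (b := id) (s := s₁) (x₀ := x₀)).1 h₁).2.continuousAt
  have c₂ := ((contMDiffAt_bilin_iff (IX := I) (IB := I) (V := (TangentSpace I : M → Type _))
    (b := id) (s := s₂) (x₀ := x₀)).1 h₂).2.continuousAt
  dsimp only [id] at c₁ c₂
  have heq := tendsto_nhds_unique_of_frequently_eq c₁ c₂ (h.mono fun x hx ↦ by rw [hx])
  set τ := trivializationAt E (TangentSpace I : M → Type _) x₀ with hτ
  have hx₀ : x₀ ∈ τ.baseSet := FiberBundle.mem_baseSet_trivializationAt' x₀
  ext v w
  have hv : τ.symmL ℝ x₀ (τ.continuousLinearMapAt ℝ x₀ v) = v := τ.symmL_continuousLinearMapAt hx₀ v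
  have hw : τ.symmL ℝ x₀ (τ.continuousLinearMapAt ℝ x₀ w) = w := τ.symmL_continuousLinearMapAt hx₀ w
  have key : s₁ x₀ (τ.symmL ℝ x₀ (τ.continuousLinearMapAt ℝ x₀ v))
      (τ.symmL ℝ x₀ (τ.continuousLinearMapAt ℝ x₀ w)) =
      s₂ x₀ (τ.symmL ℝ x₀ (τ.continuousLinearMapAt ℝ x₀ v))
        (τ.symmL ℝ x₀ (τ.continuousLinearMapAt ℝ x₀ w)) :=
    congrArg (fun β : E →L[ℝ] E →L[ℝ] ℝ ↦
      β (τ.continuousLinearMapAt ℝ x₀ v) (τ.continuousLinearMapAt ℝ x₀ w)) heq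
  rw [hv, hw] at key
  exact key

/-- **Every point of a manifold with boundary and an open collar lies in the closure of the
interior**: a boundary point `incl z` is the limit of the interior collar points `CM z t`,
`t → 0⁺`. [folklore] -/
theorem mem_closure_isInteriorPoint {n : ℕ} {M : Type u} [TopologicalSpace M]
    [ChartedSpace (EuclideanHalfSpace (n + 1)) M]
    {b : BoundaryData (𝓡∂ (n + 1)) M (𝓡 n)} (D : b.OpenCollar) (x : M) :
    x ∈ closure {a : M | (𝓡∂ (n + 1)).IsInteriorPoint a} := by
  rcases (𝓡∂ (n + 1)).isInteriorPoint_or_isBoundaryPoint x with h | h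
  · exact subset_closure h
  · have h' : x ∈ (𝓡∂ (n + 1)).boundary M := h
    rw [← b.range_incl] at h'
    obtain ⟨z, rfl⟩ := h'
    have hcont : ContinuousWithinAt (uncurry D.toFun) (univ ×ˢ Ici 0) (z, 0) :=
      D.continuousOn_toFun _ ⟨mem_univ _, le_refl (0 : ℝ)⟩
    have hpath : Tendsto (fun t : ℝ ↦ (z, t)) (𝓝[>] 0) (𝓝[univ ×ˢ Ici 0] (z, 0)) := by
      refine tendsto_nhdsWithin_iff.2 ⟨?_, ?_⟩
      · exact ((continuous_const.prodMk continuous_id).tendsto 0).mono_left nhdsWithin_le_nhds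
      · filter_upwards [self_mem_nhdsWithin] with t ht
        exact ⟨mem_univ _, mem_Ici.2 (le_of_lt ht)⟩
    have htend : Tendsto (fun t : ℝ ↦ D.toFun z t) (𝓝[>] 0) (𝓝 (b.incl z)) := by
      have h2 := hcont.tendsto.comp hpath
      rw [show uncurry D.toFun (z, 0) = b.incl z from D.apply_zero z] at h2
      exact h2
    refine mem_closure_of_tendsto htend ?_
    filter_upwards [self_mem_nhdsWithin] with t ht
    exact D.isInteriorPoint_apply z ht

variable [IsManifold I ∞ M]

/-- **A piece map which factors through the interior is isometric at interior points.**  Let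
`ι : M - ∂M → P` be smooth, `j : M → P` with `j a = ι a` at interior points, and let the fields of
bilinear forms `b` on `P`, `bM` on `M` satisfy `b (dι v, dι w) = bM (d(val) v, d(val) w)` on
`M - ∂M`.  Then `(j^* b)_c = (bM)_c` at every interior point `c` (near `c`,
`j = ι ∘ ofPt` and `val ∘ ofPt = id`; chain rule). [cite: ONeill1983, Ch. 3, p. 58] -/
theorem pullbackBilin_eq_of_isInteriorPoint
    {ι : InteriorManifold I M → P} (hι : ContMDiff 𝓘(ℝ, E) IP ∞ ι)
    {j : M → P} (hjι : ∀ (a : M) (ha : I.IsInteriorPoint a), j a = ι ⟨a, ha⟩)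
    (b : ∀ x : P, TangentSpace IP x →L[ℝ] TangentSpace IP x →L[ℝ] ℝ)
    (bM : ∀ x : M, TangentSpace I x →L[ℝ] TangentSpace I x →L[ℝ] ℝ)
    (hiso : ∀ (a : InteriorManifold I M) (v w : TangentSpace 𝓘(ℝ, E) a),
      b (ι a) (mfderiv 𝓘(ℝ, E) IP ι a v) (mfderiv 𝓘(ℝ, E) IP ι a w) =
      bM a.val (mfderiv 𝓘(ℝ, E) I InteriorManifold.val a v)
        (mfderiv 𝓘(ℝ, E) I InteriorManifold.val a w))
    {c : M} (hc : I.IsInteriorPoint c) :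
    pullbackBilin (I := IP) (I' := I) j b c = bM c := by
  set x₀ : InteriorManifold I M := ⟨c, hc⟩ with hx₀
  have hval : ∀ y, MDifferentiableAt 𝓘(ℝ, E) I
      (InteriorManifold.val : InteriorManifold I M → M) y := fun y ↦
    (InteriorManifold.contMDiff_val y).mdifferentiableAt (by simp)
  have hev : (InteriorManifold.val ∘ InteriorManifold.ofPt x₀) =ᶠ[𝓝 c] id := by
    filter_upwards [InteriorManifold.isOpen_interior_carrier.mem_nhds hc] with a ha
    exact InteriorManifold.ofPt_val_of_isInteriorPoint x₀ ha
  have hofPt : MDifferentiableAt I 𝓘(ℝ, E) (InteriorManifold.ofPt x₀) c := by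
    have h : ContMDiffAt I 𝓘(ℝ, E) ∞ (InteriorManifold.ofPt x₀) c := by
      rw [InteriorManifold.contMDiffAt_iff_comp_val]
      exact contMDiffAt_id.congr_of_eventuallyEq hev
    exact h.mdifferentiableAt (by simp)
  have hpt : InteriorManifold.ofPt x₀ c = x₀ := InteriorManifold.ofPt_of_isInteriorPoint x₀ hc
  have hjev : j =ᶠ[𝓝 c] ι ∘ InteriorManifold.ofPt x₀ := by
    filter_upwards [InteriorManifold.isOpen_interior_carrier.mem_nhds hc] with a ha
    rw [comp_apply, InteriorManifold.ofPt_of_isInteriorPoint x₀ ha]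
    exact hjι a ha
  have hιd : ∀ y, MDifferentiableAt 𝓘(ℝ, E) IP ι y := fun y ↦ (hι y).mdifferentiableAt (by simp)
  -- `dj = dι ∘ d(ofPt)` at `c`
  have hdj : ∀ v : TangentSpace I c, mfderiv I IP j c v =
      mfderiv 𝓘(ℝ, E) IP ι x₀ (mfderiv I 𝓘(ℝ, E) (InteriorManifold.ofPt x₀) c v) := fun v ↦ by
    rw [hjev.mfderiv_eq, mfderiv_comp c (hιd _) hofPt]
    exact mfderiv_congr_point' ι hpt _
  -- `d(val) ∘ d(ofPt) = id` at `c`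
  have hdv : ∀ v : TangentSpace I c, mfderiv 𝓘(ℝ, E) I InteriorManifold.val x₀
      (mfderiv I 𝓘(ℝ, E) (InteriorManifold.ofPt x₀) c v) = v := fun v ↦ by
    have h := mfderiv_comp c (hval _) hofPt
    rw [hev.mfderiv_eq, mfderiv_id] at h
    rw [← mfderiv_congr_point' InteriorManifold.val hpt]
    exact (DFunLike.congr_fun h v).symm
  ext v w
  rw [pullbackBilin_apply, bilin_congr_point_vec b (hjι c hc) (hdj v) (hdj w), hiso, hdv, hdv]

/-- **A smooth piece map which factors through the interior is isometric.**  With `ι`, `j`, as in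
`pullbackBilin_eq_of_isInteriorPoint`, `j` smooth, `g` a smooth metric on `P` and `gM` a smooth
metric on the manifold with boundary `M` (with an open collar) such that
`g (dι v, dι w) = gM (d(val) v, d(val) w)` on `M - ∂M`: then `j^* g = gM` on all of `M` — at
interior points by the chain rule, at boundary points by continuity of both smooth fields of
bilinear forms (`bilin_eq_of_frequently_eq`), boundary points being limits of interior points.
[cite: ONeill1983, Ch. 3, pp. 90–91] -/
theorem pullbackBilin_eq_of_interior_isometry [IsManifold IP ∞ P] {n : ℕ} {M : Type u}
    [TopologicalSpace M] [ChartedSpace (EuclideanHalfSpace (n + 1)) M]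
    [IsManifold (𝓡∂ (n + 1)) ∞ M]
    {bd : BoundaryData (𝓡∂ (n + 1)) M (𝓡 n)} (D : bd.OpenCollar)
    {ι : InteriorManifold (𝓡∂ (n + 1)) M → P}
    (hι : ContMDiff 𝓘(ℝ, EuclideanSpace ℝ (Fin (n + 1))) IP ∞ ι)
    {j : M → P} (hj : ContMDiff (𝓡∂ (n + 1)) IP ∞ j)
    (hjι : ∀ (a : M) (ha : (𝓡∂ (n + 1)).IsInteriorPoint a), j a = ι ⟨a, ha⟩)
    (g : PseudoRiemannianMetric IP ∞ EP (TangentSpace IP : P → Type _))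
    (gM : PseudoRiemannianMetric (𝓡∂ (n + 1)) ∞ (EuclideanSpace ℝ (Fin (n + 1)))
      (TangentSpace (𝓡∂ (n + 1)) : M → Type _))
    (hiso : ∀ (a : InteriorManifold (𝓡∂ (n + 1)) M)
      (v w : TangentSpace 𝓘(ℝ, EuclideanSpace ℝ (Fin (n + 1))) a),
      g.val (ι a) (mfderiv 𝓘(ℝ, EuclideanSpace ℝ (Fin (n + 1))) IP ι a v)
        (mfderiv 𝓘(ℝ, EuclideanSpace ℝ (Fin (n + 1))) IP ι a w) =
      gM.val a.val
        (mfderiv 𝓘(ℝ, EuclideanSpace ℝ (Fin (n + 1))) (𝓡∂ (n + 1)) InteriorManifold.val a v)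
        (mfderiv 𝓘(ℝ, EuclideanSpace ℝ (Fin (n + 1))) (𝓡∂ (n + 1)) InteriorManifold.val a w))
    (c : M) : pullbackBilin (I := IP) (I' := 𝓡∂ (n + 1)) j g.val c = gM.val c := by
  have hint : ∀ a : M, (𝓡∂ (n + 1)).IsInteriorPoint a →
      pullbackBilin (I := IP) (I' := 𝓡∂ (n + 1)) j g.val a = gM.val a := fun a ha ↦
    pullbackBilin_eq_of_isInteriorPoint hι hjι g.val gM.val hiso ha
  have hj1 : ContMDiff (𝓡∂ (n + 1)) IP (∞ + 1) j := by
    have h : ((∞ : ℕ∞ω) + 1) = ∞ := rfl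
    rw [h]
    exact hj
  refine bilin_eq_of_frequently_eq (contMDiff_pullbackBilin_holds j hj1 g c) (gM.contMDiff c) ?_
  exact (mem_closure_iff_frequently.1 (mem_closure_isInteriorPoint D c)).mono fun a ha ↦ hint a ha

end Bricks

section ThreePiece

set_option maxHeartbeats 1600000 in
/-- **Metrics with isometric collars descend to the three-piece gluing, isometrically on the
pieces** (registered sub-goal `exists_threePieceGluedMetric_isometric` of
`stub_collarGluingIsometric`).  The statement of
`Literature.Geometry.Riemannian.exists_threePieceGluedMetric` — `g_M`, `g_S`, `g_N` with
isometric collar maps descend to a smooth metric `g` with Levi-Civita connection on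
`P = (M - ∂M) ∪ (∂M × ℝ) ∪ (N - ∂N)`, the tube an isometry from `g_S`, Riemannian if the three
are, scalar curvature that of `g_M` / `g_N` / `g_S` on the three pieces — WITH the two piece
isometries `jM^* g = g_M` on `M` and `jN^* g = g_N` on `N` (same proof, two open gluings
`SmoothGlueData.exists_metric_of_glue_isometry` of the interior metrics `val^* g_M`, `val^* g_N`;
the interior isometries extend over the boundary by `pullbackBilin_eq_of_interior_isometry`).
[cite: ONeill1983, Ch. 3, pp. 90–91 and Prop. 3.59] -/
theorem exists_threePieceGluedMetric_isometric :
    ∀ (n : ℕ) (M N : Type) [TopologicalSpace M] [ChartedSpace (EuclideanHalfSpace (n + 1)) M]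
    [TopologicalSpace N] [ChartedSpace (EuclideanHalfSpace (n + 1)) N]
    (bM : Literature.Topology.FourManifolds.BoundaryData (𝓡∂ (n + 1)) M (𝓡 n))
    (bN : Literature.Topology.FourManifolds.BoundaryData (𝓡∂ (n + 1)) N (𝓡 n))
    (G : Literature.Topology.FourManifolds.BoundaryGlueData bM bN) [IsManifold (𝓡∂ (n + 1)) ∞ M]
    [Nonempty bM.carrier] [IsManifold (𝓡∂ (n + 1)) ∞ N]
    (gM : Literature.Geometry.Lorentzian.PseudoRiemannianMetric (𝓡∂ (n + 1)) ∞ (EuclideanSpace ℝ (Fin (n + 1))) (TangentSpace (𝓡∂ (n + 1)) : M → Type _))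
    [gM.HasLeviCivita]
    (gN : Literature.Geometry.Lorentzian.PseudoRiemannianMetric (𝓡∂ (n + 1)) ∞ (EuclideanSpace ℝ (Fin (n + 1))) (TangentSpace (𝓡∂ (n + 1)) : N → Type _))
    [gN.HasLeviCivita]
    (gS : Literature.Geometry.Lorentzian.PseudoRiemannianMetric ((𝓡 n).prod 𝓘(ℝ, ℝ)) ∞ (EuclideanSpace ℝ (Fin n) × ℝ) (TangentSpace ((𝓡 n).prod 𝓘(ℝ, ℝ)) : bM.carrier × ℝ → Type _))
    [gS.HasLeviCivita],
    (∀ p : bM.carrier × ℝ, 0 < p.2 → ∀ v w : TangentSpace ((𝓡 n).prod 𝓘(ℝ, ℝ)) p,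
      gM.val (G.CM.inPt p).val
        (mfderiv ((𝓡 n).prod 𝓘(ℝ, ℝ)) (𝓡∂ (n + 1)) (Literature.Topology.FourManifolds.InteriorManifold.val ∘ G.CM.inPt) p v)
        (mfderiv ((𝓡 n).prod 𝓘(ℝ, ℝ)) (𝓡∂ (n + 1)) (Literature.Topology.FourManifolds.InteriorManifold.val ∘ G.CM.inPt) p w) =
      gS.val p v w) →
    (∀ p : bM.carrier × ℝ, p.2 < 0 → ∀ v w : TangentSpace ((𝓡 n).prod 𝓘(ℝ, ℝ)) p,
      gN.val (G.CN.inPt (G.φ p.1, -p.2)).val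
        (mfderiv ((𝓡 n).prod 𝓘(ℝ, ℝ)) (𝓡∂ (n + 1)) (fun q : bM.carrier × ℝ ↦ (G.CN.inPt (G.φ q.1, -q.2)).val) p v)
        (mfderiv ((𝓡 n).prod 𝓘(ℝ, ℝ)) (𝓡∂ (n + 1)) (fun q : bM.carrier × ℝ ↦ (G.CN.inPt (G.φ q.1, -q.2)).val) p w) =
      gS.val p v w) →
    ∃ (g : Literature.Geometry.Lorentzian.PseudoRiemannianMetric (𝓡 (n + 1)) ∞ (EuclideanSpace ℝ (Fin (n + 1))) (TangentSpace (𝓡 (n + 1)) : G.d₂.Glued → Type _))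
    (_ : g.HasLeviCivita),
      (∀ (p : bM.carrier × ℝ) (v w : TangentSpace ((𝓡 n).prod 𝓘(ℝ, ℝ)) p),
        g.val (G.d₂.inl (G.d₁.inl p))
          (mfderiv ((𝓡 n).prod 𝓘(ℝ, ℝ)) (𝓡 (n + 1)) (G.d₂.inl ∘ G.d₁.inl) p v)
          (mfderiv ((𝓡 n).prod 𝓘(ℝ, ℝ)) (𝓡 (n + 1)) (G.d₂.inl ∘ G.d₁.inl) p w) =
        gS.val p v w) ∧
      (gM.IsRiemannian → gN.IsRiemannian → gS.IsRiemannian → g.IsRiemannian) ∧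
      (∀ a, g.scalarCurvature (G.d₂.inl (G.d₁.inr a)) = gM.scalarCurvature a.val) ∧
      (∀ b, g.scalarCurvature (G.d₂.inr b) = gN.scalarCurvature b.val) ∧
      (∀ p, g.scalarCurvature (G.d₂.inl (G.d₁.inl p)) = gS.scalarCurvature p) ∧
      (∀ a, Literature.Geometry.Lorentzian.pullbackBilin (I := 𝓡 (n + 1)) (I' := 𝓡∂ (n + 1)) G.jM g.val a = gM.val a) ∧
      (∀ c, Literature.Geometry.Lorentzian.pullbackBilin (I := 𝓡 (n + 1)) (I' := 𝓡∂ (n + 1)) G.jN g.val c = gN.val c) := by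
  intro n M N _ _ _ _ bM bN G _ _ _ gM _ gN _ gS _ hM hN
  -- the interior metrics `val^* gM`, `val^* gN`
  obtain ⟨gIM, hIMlc, hIMval, hIMr, hIMs⟩ := exists_metric_comap_of_injective
    (InteriorManifold.contMDiff_val (I := 𝓡∂ (n + 1)) (M := M))
    (fun a ↦ injective_mfderiv_interiorVal a) gM
  obtain ⟨gIN, hINlc, hINval, hINr, hINs⟩ := exists_metric_comap_of_injective
    (InteriorManifold.contMDiff_val (I := 𝓡∂ (n + 1)) (M := N))
    (fun a ↦ injective_mfderiv_interiorVal a) gN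
  have hiso₁ := glue₁_isometry_of_collar G gM gS gIM hIMval hM
  obtain ⟨g₁, hA₁, hB₁⟩ := G.d₁.exists_metric_of_glue_isometry gS gIM hiso₁
  -- second gluing: `X = d₁.Glued` and interior of `N`
  have hiso₂ := glue₂_isometry_of_collar G gN gS gIN hINval g₁ hA₁ hN
  obtain ⟨g, hA₂, hB₂⟩ := G.d₂.exists_metric_of_glue_isometry g₁ gIN hiso₂
  haveI hglc : g.HasLeviCivita := g.hasLeviCivita
  -- the tube isometry
  have htube : ∀ (p : bM.carrier × ℝ) (v w : TangentSpace ((𝓡 n).prod 𝓘(ℝ, ℝ)) p),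
      g.val (G.d₂.inl (G.d₁.inl p))
        (mfderiv ((𝓡 n).prod 𝓘(ℝ, ℝ)) 𝓘(ℝ, EuclideanSpace ℝ (Fin (n + 1))) (G.d₂.inl ∘ G.d₁.inl) p v)
        (mfderiv ((𝓡 n).prod 𝓘(ℝ, ℝ)) 𝓘(ℝ, EuclideanSpace ℝ (Fin (n + 1))) (G.d₂.inl ∘ G.d₁.inl) p w) =
      gS.val p v w := fun p v w ↦ by
    rw [mfderiv_comp p (G.d₂.contMDiff_inl.mdifferentiableAt (by simp))
      (G.d₁.contMDiff_inl.mdifferentiableAt (by simp))]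
    show g.val (G.d₂.inl (G.d₁.inl p)) (mfderiv _ _ G.d₂.inl _ (mfderiv _ _ G.d₁.inl p v))
      (mfderiv _ _ G.d₂.inl _ (mfderiv _ _ G.d₁.inl p w)) = _
    rw [hA₂, hA₁]
  -- the interior-of-`M` isometry
  have hintM : ∀ (a : InteriorManifold (𝓡∂ (n + 1)) M) (v w : TangentSpace 𝓘(ℝ, EuclideanSpace ℝ (Fin (n + 1))) a),
      g.val (G.d₂.inl (G.d₁.inr a))
        (mfderiv 𝓘(ℝ, EuclideanSpace ℝ (Fin (n + 1))) 𝓘(ℝ, EuclideanSpace ℝ (Fin (n + 1))) (G.d₂.inl ∘ G.d₁.inr) a v)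
        (mfderiv 𝓘(ℝ, EuclideanSpace ℝ (Fin (n + 1))) 𝓘(ℝ, EuclideanSpace ℝ (Fin (n + 1))) (G.d₂.inl ∘ G.d₁.inr) a w) =
      gIM.val a v w := fun a v w ↦ by
    rw [mfderiv_comp a (G.d₂.contMDiff_inl.mdifferentiableAt (by simp))
      (G.d₁.contMDiff_inr.mdifferentiableAt (by simp))]
    show g.val (G.d₂.inl (G.d₁.inr a)) (mfderiv _ _ G.d₂.inl _ (mfderiv _ _ G.d₁.inr a v))
      (mfderiv _ _ G.d₂.inl _ (mfderiv _ _ G.d₁.inr a w)) = _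
    rw [hA₂, hB₁]
  refine ⟨g, hglc, htube, fun hgM hgN hgS ↦ ?_, fun a ↦ ?_, fun b ↦ ?_, fun p ↦ ?_, ?_, ?_⟩
  · -- Riemannian
    exact G.d₂.isRiemannian_of_glue g₁ gIN g hA₂ hB₂
      (G.d₁.isRiemannian_of_glue gS gIM g₁ hA₁ hB₁ hgS (hIMr hgM)) (hINr hgN)
  · -- scalar curvature at interior points of `M`
    obtain ⟨gQ, hQlc, hQval, -, hQs⟩ := exists_metric_comap_of_injective
      (Ψ := G.d₂.inl ∘ G.d₁.inr) (G.d₂.contMDiff_inl.comp G.d₁.contMDiff_inr)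
      (G.injective_mfderiv_inl_inr) g
    have hv : ∀ x, gQ.val x = gIM.val x := fun x ↦ by
      ext v w
      rw [hQval]
      exact hintM x v w
    rw [← hIMs a, ← scalarCurvature_congr_of_val_eq hv a, hQs a]
    rfl
  · -- scalar curvature at interior points of `N`
    obtain ⟨gQ, hQlc, hQval, -, hQs⟩ := exists_metric_comap_of_injective
      G.d₂.contMDiff_inr (fun b ↦ (G.d₂.mfderiv_inr_bijective b).1) g
    have hv : ∀ x, gQ.val x = gIN.val x := fun x ↦ by
      ext v w
      rw [hQval]
      exact hB₂ x v w
    rw [← hINs b, ← scalarCurvature_congr_of_val_eq hv b, hQs b]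
  · -- scalar curvature on the tube (different model vector space: `scalarCurvature_comap`)
    have h1 : ContMDiff ((𝓡 n).prod 𝓘(ℝ, ℝ)) 𝓘(ℝ, EuclideanSpace ℝ (Fin (n + 1))) (∞ + 1) (G.d₂.inl ∘ G.d₁.inl) := by
      have h : ((∞ : ℕ∞ω) + 1) = ∞ := rfl
      rw [h]
      exact G.contMDiff_inl_inl
    have hinj : ∀ p, Injective (mfderiv ((𝓡 n).prod 𝓘(ℝ, ℝ)) 𝓘(ℝ, EuclideanSpace ℝ (Fin (n + 1)))
        (G.d₂.inl ∘ G.d₁.inl) p) := fun p ↦ (G.bijective_mfderiv_inl_inl p).1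
    have hdim : Module.finrank ℝ (EuclideanSpace ℝ (Fin n) × ℝ) = Module.finrank ℝ (EuclideanSpace ℝ (Fin (n + 1))) := by
      rw [Module.finrank_prod, Module.finrank_self, finrank_euclideanSpace_fin,
        finrank_euclideanSpace_fin]
    set gQ := g.comap contMDiff_pullbackBilin_holds (G.d₂.inl ∘ G.d₁.inl) h1 hinj hdim with hgQ
    haveI hQlc : gQ.HasLeviCivita := gQ.hasLeviCivita
    have hv : ∀ x, gQ.val x = gS.val x := fun x ↦ by
      ext v w
      rw [hgQ, val_comap, pullbackBilin_apply]
      exact htube x v w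
    rw [← scalarCurvature_congr_of_val_eq hv p]
    exact (g.scalarCurvature_comap contMDiff_pullbackBilin_holds h1 hinj hdim p).symm
  · -- `jM^* g = gM`: interior isometry `hintM` + `hIMval`, then continuity at the boundary
    refine pullbackBilin_eq_of_interior_isometry G.CM (ι := G.d₂.inl ∘ G.d₁.inr)
      (G.d₂.contMDiff_inl.comp G.d₁.contMDiff_inr) G.isImmersion_jM.contMDiff
      (fun a ha ↦ G.jM_of_isInteriorPoint ha) g gM fun a v w ↦ ?_
    exact (hintM a v w).trans (hIMval a v w)
  · -- `jN^* g = gN`: interior isometry `hB₂` + `hINval`, then continuity at the boundary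
    refine pullbackBilin_eq_of_interior_isometry G.CN (ι := G.d₂.inr) G.d₂.contMDiff_inr
      G.isImmersion_jN.contMDiff (fun c hc ↦ G.jN_of_isInteriorPoint hc) g gN fun b v w ↦ ?_
    exact (hB₂ b v w).trans (hINval b v w)

end ThreePiece

end Summit.SmoothPoincare4.SmoothPoincare4.Theorems.CorkRegluingBudget

end
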